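import Mathlib
import Summits.NavierStokesRegularity.NavierStokesRegularity.Theorems.TaoLadderRungTwoBreakOneShiftSelfMapRows
import HarnessLib

/-!
# Kernel STAGE 3, window-side reduction: the engine's PRIMITIVE window constants (Lipschitz in the window
# metric and in the two edge inputs) give the solved-form window hypotheses of the end-to-end theorem
# (cell harvest/h2-tao-ladder, seat p2; rung1/KERNEL-STAGE3-PLAN.md brick (8); support for K1(1) =
# `NoSurvivingDSSOne`, stmt-NavierStokesRegularity-20205)

MODEL lattice ODEs only; nothing about the Navier–Stokes equations; no item closed; CONDITIONAL glue.

The engine (rung1/num4c, STAGE3 lines) certifies Lipschitz bounds of the window block of the form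
«variation ≤ Z·(window distance) + S_b·(sup of the wake-edge difference) + S_e·(sup of the top-edge difference)».
In TRAJECTORY space the two edge inputs ARE coordinates, so `sup|Δb| ≤ wt_{-1}·dist` and `sup|Δe| ≤ wt_W·dist`
(`abs_decodeTail_sub_le`) and no intermediate linear system (STAGE3-BANACH (r1)–(r8)) is needed: each
solved-form constant is a linear combination, `q_X = Z + S_b wt_{-1} + S_e wt_W` etc.
(`lipschitz_of_edgeForm`). `exists_surviving_dssWave_of_windowCert_v4` restates the end-to-end theorem
(p623026's `…_v3`) with the window-side hypotheses in this primitive edge form.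
-/

noncomputable section

-- `Summit.NavierStokesRegularity.NavierStokesRegularity.…` is the tree's (summit = problem) namespace; the
-- duplicated component is intended, so the dupNamespace linter is silenced for this file.
set_option linter.dupNamespace false

namespace Summit.NavierStokesRegularity.NavierStokesRegularity.Theorems

namespace DSSOneShift

open Set MeasureTheory intervalIntegral
open Literature.Analysis.FluidPDE Literature.Analysis.FluidPDE.TaoCascade CertificateGlueOn

variable {m : ℕ}

namespace OneShiftFrame

variable (F : OneShiftFrame m)

/-- **Edge form ⟹ solved form.** If a real quantity `Δ` attached to two points satisfies
`Δ ≤ Z·dist u v + S_b·B + S_e·E` for ALL bounds `B` of the wake-edge difference (shell `-1`) and `E` of the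
top-edge difference (shell `W`) along the flight, then `Δ ≤ (Z + S_b wt_{-1} + S_e wt_W)·dist u v` (take
`B = wt_{-1}·dist`, `E = wt_W·dist`).
[folklore; cell vocabulary, harvest/h2-tao-ladder rung1/STAGE3-BANACH.md §2 (the edge channels)] -/
theorem lipschitz_of_edgeForm {Z Sb Se Δ : ℝ} (u v : F.Space)
    (h : ∀ B E : ℝ, (∀ i, ∀ t ∈ Icc 0 F.τhi, |F.decodeTail u i (-1) t - F.decodeTail v i (-1) t| ≤ B) →
      (∀ i, ∀ t ∈ Icc 0 F.τhi, |F.decodeTail u i F.W t - F.decodeTail v i F.W t| ≤ E) →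
        Δ ≤ Z * dist u v + Sb * B + Se * E) :
    Δ ≤ (Z + Sb * F.wt (-1) + Se * F.wt F.W) * dist u v := by
  have hb := h (F.wt (-1) * dist u v) (F.wt F.W * dist u v)
    (fun i t _ => F.abs_decodeTail_sub_le u v i (-1) t) (fun i t _ => F.abs_decodeTail_sub_le u v i F.W t)
  linarith

/-- **KERNEL STAGE 3 — end-to-end, window side in the engine's EDGE FORM.** As `…_v3` (p623026) with the four
window-side Lipschitz hypotheses replaced by their primitive edge forms: the raw window block (`Z, S_b, S_e`),
the renormalisation factor (`γ_x, γ_b, γ_e`), the window bottom at the moving flight time (`dz₀, χ_b, χ_e`),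
and every window shell along the flight (`vmax, χ^b_max, χ^e_max` per shell). [cite: Tao2016AveragedNS, §4 Lemma 4.1 (4.8), §5.3–§6; cell vocabulary, harvest/h2-tao-ladder rung1/STAGE3-BANACH.md §2 (H-lip (a)–(e)), rung1/KERNEL-STAGE3-PLAN.md §6] -/
theorem exists_surviving_dssWave_of_windowCert_v4 {ε₀ Mα Q β C₀ ϱ q gHi A1 : ℝ}
    {Z Sb Se γx γb γe dz0 χb χe : ℝ}
    {α : Fin m → Fin m → Fin m → ℤ × ℤ × ℤ → ℝ} (cert : OneShiftWindowCert F ε₀ α)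
    (R A devC vmax χbm χem : ℤ → ℝ)
    (hε : 0 < 1 + ε₀) (hMα : 0 ≤ Mα) (hα : ∀ i₁ i₂ i₃ μ, |α i₁ i₂ i₃ μ| ≤ Mα) (hW1 : 1 ≤ F.W)
    (hq : 0 ≤ q) (hq1 : q < 1) (hA0 : ∀ k, 0 ≤ A k)
    (hAtail : ∀ j k', ¬ F.InWindow k' → |F.tubeC j k'| + F.tubeR k' ≤ A k')
    (hAwin : ∀ w, F.Adm w → ∀ j k', F.InWindow k' → ∀ s ∈ Icc 0 F.τhi, |F.fullFamily cert w j k' s| ≤ A k')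
    (hRrow : ∀ k : ℤ, (m : ℝ) ^ 2 * Mα * ((1 + ε₀) ^ ((5 : ℝ) * k / 2) * (A k * A k + 2 * (A k * A (k + 1))) +
        (1 + ε₀) ^ ((5 : ℝ) * ((k : ℝ) - 1) / 2) * (A (k - 1) * A (k - 1))) ≤ R k)
    (hg0 : ∀ w, F.Adm w → 0 ≤ gfac (slice (F.fullFamily cert w) (F.decodeTau w)) ∧
      gfac (slice (F.fullFamily cert w) (F.decodeTau w)) ≤ gHi)
    -- window side, EDGE FORM (the engine's STAGE3 lines)
    (hWedge : ∀ u v, F.AdmLip R u → F.AdmLip R v → ∀ B E : ℝ,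
      (∀ i, ∀ t ∈ Icc 0 F.τhi, |F.decodeTail u i (-1) t - F.decodeTail v i (-1) t| ≤ B) →
      (∀ i, ∀ t ∈ Icc 0 F.τhi, |F.decodeTail u i F.W t - F.decodeTail v i F.W t| ≤ E) →
        dist (F.rawWindow cert u) (F.rawWindow cert v) ≤ Z * dist u v + Sb * B + Se * E)
    (hγedge : ∀ u v, F.AdmLip R u → F.AdmLip R v → ∀ B E : ℝ,
      (∀ i, ∀ t ∈ Icc 0 F.τhi, |F.decodeTail u i (-1) t - F.decodeTail v i (-1) t| ≤ B) →
      (∀ i, ∀ t ∈ Icc 0 F.τhi, |F.decodeTail u i F.W t - F.decodeTail v i F.W t| ≤ E) →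
        |gfac (slice (F.fullFamily cert u) (F.decodeTau u)) -
          gfac (slice (F.fullFamily cert v) (F.decodeTau v))| ≤ γx * dist u v + γb * B + γe * E)
    (hZedge : ∀ u v, F.AdmLip R u → F.AdmLip R v → ∀ i, ∀ B E : ℝ,
      (∀ i, ∀ t ∈ Icc 0 F.τhi, |F.decodeTail u i (-1) t - F.decodeTail v i (-1) t| ≤ B) →
      (∀ i, ∀ t ∈ Icc 0 F.τhi, |F.decodeTail u i F.W t - F.decodeTail v i F.W t| ≤ E) →
        |F.fullFamily cert u i 0 (F.decodeTau u) - F.fullFamily cert v i 0 (F.decodeTau v)| ≤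
          dz0 * dist u v + χb * B + χe * E)
    (hDedge : ∀ u v, F.AdmLip R u → F.AdmLip R v → ∀ j k', F.InWindow k' → ∀ s ∈ Icc 0 F.τhi, ∀ B E : ℝ,
      (∀ i, ∀ t ∈ Icc 0 F.τhi, |F.decodeTail u i (-1) t - F.decodeTail v i (-1) t| ≤ B) →
      (∀ i, ∀ t ∈ Icc 0 F.τhi, |F.decodeTail u i F.W t - F.decodeTail v i F.W t| ≤ E) →
        |F.fullFamily cert u j k' s - F.fullFamily cert v j k' s| ≤ vmax k' * dist u v + χbm k' * B + χem k' * E)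
    -- rows with the solved-form constants substituted
    (hqX : Z + Sb * F.wt (-1) + Se * F.wt F.W ≤ q)
    (hrow : ∀ i k, ¬ F.InWindow k →
      gHi * (if F.InWindow (k + 1) then dz0 + χb * F.wt (-1) + χe * F.wt F.W
          else F.wt (k + 1) + R (k + 1) * F.rτ) + A (k + 1) * (γx + γb * F.wt (-1) + γe * F.wt F.W) +
        F.τhi * quadTermLip ε₀ α A
          (fun k' => if F.InWindow k' then vmax k' + χbm k' * F.wt (-1) + χem k' * F.wt F.W else F.wt k') i k ≤
        q * F.wt k)
    (h0 : ∃ u, F.AdmLip R u)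
    (hwinIn : ∀ u, F.AdmLip R u →
      (∀ i k, |(F.rawWindow cert u).1 i k| ≤ 1) ∧ |(F.rawWindow cert u).2| ≤ 1)
    (hdev : ∀ w, F.Adm w → ∀ i k, ¬ F.InWindow k → ¬ F.InWindow (k + 1) →
      |gfac (slice (F.fullFamily cert w) (F.decodeTau w)) * F.tubeC i (k + 1) - F.tubeC i k| ≤ devC k)
    (hA1 : ∀ w, F.Adm w → ∀ i,
      |gfac (slice (F.fullFamily cert w) (F.decodeTau w)) * F.fullFamily cert w i 0 (F.decodeTau w) -
        F.tubeC i (-1)| ≤ A1)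
    (hrows : ∀ k, ¬ F.InWindow k → ¬ F.InWindow (k + 1) →
      gHi * F.tubeR (k + 1) + devC k + F.τhi * R k ≤ F.tubeR k)
    (hrow1 : A1 + F.τhi * R (-1) ≤ F.tubeR (-1))
    (hg : ∀ u, F.AdmLip R u →
      1 < gfac (slice (F.fullFamily cert u) (F.decodeTau u)) ^ 2 ∧
        gfac (slice (F.fullFamily cert u) (F.decodeTau u)) ^ 2 ≤ 1 + ε₀ ∧
        gfac (slice (F.fullFamily cert u) (F.decodeTau u)) < bigLam ε₀ ∧
        β ^ 2 < gfac (slice (F.fullFamily cert u) (F.decodeTau u)) * bigLam ε₀)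
    (hQA : A 0 ≤ Q) (hβ1 : 1 ≤ β)
    (hwakeTube : ∀ i (n : ℕ), 1 ≤ n → |F.tubeC i (-(n : ℤ))| + F.tubeR (-(n : ℤ)) ≤ Q * β ^ n)
    (hϱ : 0 < ϱ) (hϱ1 : ϱ * bigLam ε₀ < 1) (hC₀ : 0 ≤ C₀)
    (htopTube : ∀ i (j : ℕ), |F.tubeC i ((F.W : ℤ) + j)| + F.tubeR ((F.W : ℤ) + j) ≤ C₀ * ϱ ^ (F.W + j))
    (hne : ∃ i, F.a i 0 < |F.yc i 0|) :
    ∃ (T : ℝ) (Φ : Unit → ℝ → Em m), 0 < T ∧ IsDSSWave ε₀ α (Equiv.refl Unit) T Φ ∧ Surviving 1 ε₀ T ∧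
      ∃ x, Φ () x ≠ 0 := by
  refine F.exists_surviving_dssWave_of_windowCert_v3 cert R A
    (fun k' => vmax k' + χbm k' * F.wt (-1) + χem k' * F.wt F.W) devC hε hMα hα hW1 hq hq1 hA0 hAtail hAwin
    hRrow hg0 ?_ ?_ ?_ hrow ?_ h0 hwinIn hdev hA1 hrows hrow1 hg hQA hβ1 hwakeTube hϱ hϱ1 hC₀ htopTube hne
  · intro u v hu hv
    exact F.lipschitz_of_edgeForm u v (hγedge u v hu hv)
  · intro u v hu hv i
    exact F.lipschitz_of_edgeForm u v (hZedge u v hu hv i)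
  · intro u v hu hv j k' hk' s hs
    exact F.lipschitz_of_edgeForm u v (hDedge u v hu hv j k' hk' s hs)
  · intro u v hu hv
    have h := F.lipschitz_of_edgeForm u v (hWedge u v hu hv)
    exact h.trans (mul_le_mul_of_nonneg_right hqX dist_nonneg)

end OneShiftFrame

end DSSOneShift

end Summit.NavierStokesRegularity.NavierStokesRegularity.Theorems
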